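import Literature.Geometry.Lorentzian.ChartWeyl
import Literature.Geometry.Lorentzian.CurvatureNaturality
import Literature.Geometry.Lorentzian.ConformalChangeFour
import Literature.Geometry.Lorentzian.ConformalVolume
import Literature.Geometry.Riemannian.ChangGurskyYangProofs
import HarnessLib

/-!
# `|W_{ψ²g}|² = ψ⁻⁴ |W_g|²` on a manifold: naturality of the Weyl tensor and the pointwise
# conformal law of the Weyl norm

Topic `Geometry/Riemannian` (everything proved; no definition, no statement of `Prop` type). The
manifold form of the conformal covariance of the Weyl tensor proved in charts in
`Lorentzian/ConformalCoordWeyl.lean` (`W' = W`, Besse 1987, Thm. 1.159) and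
`Lorentzian/ChartWeyl.lean` (`W'_{ijkl}(e/a) = a⁻² W_{ijkl}(e)` for metrics on `U : Opens E`),
transported to manifolds modelled on their model space `E` exactly as the scalar-curvature law
`PseudoRiemannianMetric.scalarCurvature_conformal_sq_four` of `ConformalChangeFour.lean`: pull both
metrics back along the inverse chart at `x` (`PseudoRiemannianMetric.comap`, a local isometry) and
use the NATURALITY of the Weyl tensor under local diffeomorphisms, which follows from that of the
Riemann, Ricci and scalar curvature (`riemann_comap_apply`, `ricci_comap_apply`,
`scalarCurvature_comap`, `CurvatureNaturality.lean`; O'Neill 1983, Ch. 3, Prop. 3.59).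

* `PseudoRiemannianMetric.weylFrame_comap` — (with a private copy of
  `curvatureForm_comap_leviCivita` of `AlmostNonnegativeCurvatureSmoothingProofs.lean`) the frame Weyl
  tensor of `Φ^*g` at `u` on a frame `e` are those of `g` at `Φ u` on the frame `dΦ ∘ e`; proved for
  a `C^n` metric, `n ≥ 2`, and a `C^{n+1}` map `Φ` as `weylFrame_comap_cn` (from
  `riemann_comap_apply_cn`, `ricci_comap_apply_cn`, `scalarCurvature_comap_cn` of
  `CurvatureNaturality.lean`), of which the `C^∞` statement `weylFrame_comap` (unchanged name and
  signature) is the specialisation `n = ∞` — the finite-regularity case serves the `C²` conformal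
  compactification of a conformally compact metric (Li–Qing–Shi 2017, Def. 2.1, Lemma 1.6);
  `.isOrthonormalFrame_comap_iff` — `e` is `Φ^*g`-orthonormal iff `dΦ ∘ e` is `g`-orthonormal (any
  regularity);
  `.weylNormSqFrame_comap`, `.weylNormSq_comap` — `|W_{Φ^*g}|²(u) = |W_g|²(Φ u)` (for a Riemannian
  `g`, through one orthonormal frame and frame independence `weylNormSq_eq_weylNormSqFrame`).
* `PseudoRiemannianMetric.weylNormSq_conformal_sq` — **the pointwise conformal law on a manifold**
  modelled on `E`, `dim E ≥ 3`: for smooth metrics `g` (Riemannian), `g'` with their Levi-Civita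
  connections and a smooth positive `ψ` with `g' = ψ² g` pointwise,
  **`|W_{g'}|²(x) = ψ(x)⁻⁴ |W_g|²(x)`** at every point (`(0,4)`-norm `weylNormSq` of
  `WeylEnergy.lean`). In dimension four, with `dμ_{ψ²g} = ψ⁴ dμ_g`
  (`riemannianMeasure_eq_withDensity_of_conformal_sq_four`, `ConformalVolume.lean`), this is the
  conformal invariance of the Weyl energy `∫|W|² dμ` — "the `L²` norm of `W⁺` is conformally
  invariant" (Gursky–LeBrun 1999, §3, proof of Theorem 1; Besse 1987, 1.159):
* `PseudoRiemannianMetric.weylEnergy_conformal_sq_four` — **`∫|W_{ψ²g}|² dV_{ψ²g} = ∫|W_g|² dV_g`**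
  on a compact `4`-manifold (`weylEnergy` of `WeylEnergy.lean`).

## References

* A. L. Besse, *Einstein manifolds*, Springer 1987, Thm. 1.159 (conformal invariance of `W`).
  [Besse1987]
* B. O'Neill, *Semi-Riemannian geometry*, Academic Press 1983, Ch. 3, Prop. 3.59 (isometries
  preserve curvature). [ONeill1983]
* M. J. Gursky, C. LeBrun, Ann. Global Anal. Geom. 17 (1999) 315–328 (arXiv:math/9807055), §3.
  [GurskyLebrun1999]
-/

noncomputable section

set_option maxSynthPendingDepth 3

open Bundle Set Function Filter Manifold Module
open scoped Manifold ContDiff Topology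

namespace Literature.Geometry.Lorentzian

namespace PseudoRiemannianMetric

/-! ### Naturality of the Weyl tensor under local diffeomorphisms: `C^n` metric, `n ≥ 2` -/

section NaturalityCn

variable {E : Type*} [NormedAddCommGroup E] [NormedSpace ℝ E] {H : Type*} [TopologicalSpace H]
  {I : ModelWithCorners ℝ E H} {M : Type*} [TopologicalSpace M] [ChartedSpace H M]
  [IsManifold I ∞ M]
  {E' : Type*} [NormedAddCommGroup E'] [NormedSpace ℝ E'] {H' : Type*} [TopologicalSpace H']
  {I' : ModelWithCorners ℝ E' H'} {N : Type*} [TopologicalSpace N] [ChartedSpace H' N]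
  [IsManifold I' ∞ N]
  [FiniteDimensional ℝ E] [FiniteDimensional ℝ E'] [CompleteSpace E] [CompleteSpace E']
  {n : ℕ∞ω} [Fact (1 ≤ n)]
  (g : PseudoRiemannianMetric I n E (TangentSpace I : M → Type _))
  {Φ : N → M} (hpb : contMDiff_pullbackBilin I M I' N n) (hΦ : ContMDiff I' I (n + 1) Φ)
  (hΦ' : ∀ u, Function.Injective (mfderiv I' I Φ u))
  (hdim : Module.finrank ℝ E' = Module.finrank ℝ E)

include hΦ' in
/-- **Naturality of the covariant curvature tensor**, `C^n` metric, `n ≥ 2`: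
`Rm^{Φ^*g}_u(a,b,c,d) = Rm^g_{Φ u}(dΦ a, dΦ b, dΦ c, dΦ d)` (`riemann_comap_apply_cn` lowered with
`Φ^*g`; O'Neill 1983, Ch. 3, Prop. 3.59) — a PRIVATE copy of
`PseudoRiemannianMetric.curvatureForm_comap_leviCivita` of
`Riemannian/AlmostNonnegativeCurvatureSmoothingProofs.lean` (the public theorem to cite, `C^∞`; not
imported here to keep the Ricci-flow development out of this file's closure), at finite regularity.
[cite: ONeill1983, Ch. 3, Prop. 3.59] -/
private theorem curvatureForm_comap_aux [g.HasLeviCivita] [(g.comap hpb Φ hΦ hΦ' hdim).HasLeviCivita]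
    (hn : 2 ≤ n) (u : N) (a b c d : TangentSpace I' u) :
    (g.comap hpb Φ hΦ hΦ' hdim).curvatureForm (g.comap hpb Φ hΦ hΦ' hdim).leviCivita u a b c d =
      g.curvatureForm g.leviCivita (Φ u) (mfderiv I' I Φ u a) (mfderiv I' I Φ u b)
        (mfderiv I' I Φ u c) (mfderiv I' I Φ u d) := by
  have hinv := isInvertible_mfderiv_of_injective (Φ := Φ) hdim (hΦ' u)
  unfold curvatureForm
  rw [show (g.comap hpb Φ hΦ hΦ' hdim).leviCivita.curvature u a b c =
      (g.comap hpb Φ hΦ hΦ' hdim).riemann u a b c from rfl,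
    show g.leviCivita.curvature (Φ u) (mfderiv I' I Φ u a) (mfderiv I' I Φ u b) (mfderiv I' I Φ u c) =
      g.riemann (Φ u) (mfderiv I' I Φ u a) (mfderiv I' I Φ u b) (mfderiv I' I Φ u c) from rfl,
    g.riemann_comap_apply_cn hpb hΦ hΦ' hdim hn u a b c, val_comap, pullbackBilin_apply,
    hinv.self_apply_inverse]

include hΦ' in
/-- **Naturality of the frame Weyl tensor, `C^n` metric, `n ≥ 2`, `C^{n+1}` map `Φ`**: the Weyl
components of `Φ^*g` at `u` in a frame `e` are those of `g` at `Φ u` in the frame `dΦ_u ∘ e` (from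
the naturality of `Rm`, `Ric`, `S`: `riemann_comap_apply_cn`, `ricci_comap_apply_cn`,
`scalarCurvature_comap_cn`). The `C^∞` statement is `weylFrame_comap`.
[cite: ONeill1983, Ch. 3, Prop. 3.59] [cite: Besse1987, (1.116)] -/
theorem weylFrame_comap_cn [g.HasLeviCivita] [(g.comap hpb Φ hΦ hΦ' hdim).HasLeviCivita]
    (hn : 2 ≤ n) (u : N) {ι : Type*} [Fintype ι] [DecidableEq ι] (e : ι → TangentSpace I' u)
    (i j k l : ι) :
    (g.comap hpb Φ hΦ hΦ' hdim).weylFrame u e i j k l =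
      g.weylFrame (Φ u) (fun i ↦ mfderiv I' I Φ u (e i)) i j k l := by
  simp only [Literature.Geometry.Lorentzian.PseudoRiemannianMetric.weylFrame_apply,
    g.curvatureForm_comap_aux hpb hΦ hΦ' hdim hn, g.ricci_comap_apply_cn hpb hΦ hΦ' hdim hn,
    g.scalarCurvature_comap_cn hpb hΦ hΦ' hdim hn]

omit [CompleteSpace E] [CompleteSpace E'] [Fact (1 ≤ n)] in
/-- A frame `e` at `u` is `Φ^*g`-orthonormal iff `dΦ_u ∘ e` is `g`-orthonormal at `Φ u`
(`(Φ^*g)_u(v,w) = g_{Φu}(dΦ v, dΦ w)`; any regularity of `g`). [cite: ONeill1983, Ch. 3, p. 90] -/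
theorem isOrthonormalFrame_comap_iff (u : N) {ι : Type*} (e : ι → TangentSpace I' u) :
    (g.comap hpb Φ hΦ hΦ' hdim).IsOrthonormalFrame u e ↔
      g.IsOrthonormalFrame (Φ u) (fun i ↦ mfderiv I' I Φ u (e i)) := by
  simp only [Literature.Geometry.Lorentzian.PseudoRiemannianMetric.IsOrthonormalFrame, val_comap,
    pullbackBilin_apply]

end NaturalityCn

/-! ### Naturality of the Weyl tensor under local diffeomorphisms (`C^∞`) -/

section Naturality

variable {E : Type*} [NormedAddCommGroup E] [NormedSpace ℝ E] {H : Type*} [TopologicalSpace H]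
  {I : ModelWithCorners ℝ E H} {M : Type*} [TopologicalSpace M] [ChartedSpace H M]
  [IsManifold I ∞ M]
  {E' : Type*} [NormedAddCommGroup E'] [NormedSpace ℝ E'] {H' : Type*} [TopologicalSpace H']
  {I' : ModelWithCorners ℝ E' H'} {N : Type*} [TopologicalSpace N] [ChartedSpace H' N]
  [IsManifold I' ∞ N]
  [FiniteDimensional ℝ E] [FiniteDimensional ℝ E'] [CompleteSpace E] [CompleteSpace E']
  (g : PseudoRiemannianMetric I ∞ E (TangentSpace I : M → Type _))
  {Φ : N → M} (hpb : contMDiff_pullbackBilin I M I' N ∞) (hΦ : ContMDiff I' I (∞ + 1) Φ)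
  (hΦ' : ∀ u, Function.Injective (mfderiv I' I Φ u))
  (hdim : Module.finrank ℝ E' = Module.finrank ℝ E)

include hΦ' in
/-- **Naturality of the frame Weyl tensor**: the Weyl components of `Φ^*g` at `u` in a frame `e`
are those of `g` at `Φ u` in the frame `dΦ_u ∘ e` (from `curvatureForm_comap_leviCivita`,
`ricci_comap_apply`, `scalarCurvature_comap`; `weylFrame_comap_cn` at `n = ∞`).
[cite: ONeill1983, Ch. 3, Prop. 3.59] [cite: Besse1987, (1.116)] -/
theorem weylFrame_comap [g.HasLeviCivita] [(g.comap hpb Φ hΦ hΦ' hdim).HasLeviCivita]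
    (u : N) {ι : Type*} [Fintype ι] [DecidableEq ι] (e : ι → TangentSpace I' u) (i j k l : ι) :
    (g.comap hpb Φ hΦ hΦ' hdim).weylFrame u e i j k l =
      g.weylFrame (Φ u) (fun i ↦ mfderiv I' I Φ u (e i)) i j k l :=
  g.weylFrame_comap_cn hpb hΦ hΦ' hdim (WithTop.coe_le_coe.mpr le_top) u e i j k l

include hΦ' in
/-- **`|W_{Φ^*g}|²(e) = |W_g|²(dΦ ∘ e)`** for the frame norms `Σ W²`. [cite: ONeill1983, Ch. 3, Prop. 3.59] -/
theorem weylNormSqFrame_comap [g.HasLeviCivita] [(g.comap hpb Φ hΦ hΦ' hdim).HasLeviCivita]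
    (u : N) {ι : Type*} [Fintype ι] [DecidableEq ι] (e : ι → TangentSpace I' u) :
    (g.comap hpb Φ hΦ hΦ' hdim).weylNormSqFrame u e =
      g.weylNormSqFrame (Φ u) (fun i ↦ mfderiv I' I Φ u (e i)) := by
  simp only [Literature.Geometry.Lorentzian.PseudoRiemannianMetric.weylNormSqFrame,
    g.weylFrame_comap hpb hΦ hΦ' hdim]

include hΦ' in
/-- **Naturality of the Weyl norm**: `|W_{Φ^*g}|²(u) = |W_g|²(Φ u)` for a Riemannian `g` — pull an
orthonormal basis of `T_{Φu}M` back by `(dΦ_u)⁻¹` to an orthonormal frame of `Φ^*g`, and use frame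
independence (`weylNormSq_eq_weylNormSqFrame`) on both sides. [cite: ONeill1983, Ch. 3, Prop. 3.59]
[cite: Besse1987, (1.116)] -/
theorem weylNormSq_comap [g.HasLeviCivita] [(g.comap hpb Φ hΦ hΦ' hdim).HasLeviCivita]
    (hg : g.IsRiemannian) (u : N) :
    (g.comap hpb Φ hΦ hΦ' hdim).weylNormSq u = g.weylNormSq (Φ u) := by
  have hinv := isInvertible_mfderiv_of_injective (Φ := Φ) hdim (hΦ' u)
  -- an orthonormal basis of `T_{Φ u} M`, indexed by `Fin (dim E')`
  obtain ⟨b, hb⟩ := g.exists_basis_isOrthonormalFrame (hg (Φ u)) hdim.symm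
  -- its pullback is `Φ^*g`-orthonormal
  set e : Fin (Module.finrank ℝ E') → TangentSpace I' u :=
    fun i ↦ (mfderiv I' I Φ u).inverse (b i) with he
  have hde : (fun i ↦ mfderiv I' I Φ u (e i)) = ⇑b := by
    funext i
    exact hinv.self_apply_inverse (b i)
  have he' : (g.comap hpb Φ hΦ hΦ' hdim).IsOrthonormalFrame u e := by
    rw [g.isOrthonormalFrame_comap_iff hpb hΦ hΦ' hdim, hde]
    exact hb
  -- an orthonormal basis of `T_{Φ u} M` indexed by `Fin (dim E)` for the right-hand side
  have hb' : g.IsOrthonormalFrame (Φ u) (⇑b ∘ Fin.cast hdim.symm) :=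
    hb.comp (Fin.cast_injective _)
  rw [(g.comap hpb Φ hΦ hΦ' hdim).weylNormSq_eq_weylNormSqFrame he',
    g.weylNormSq_eq_weylNormSqFrame hb', g.weylNormSqFrame_comap hpb hΦ hΦ' hdim, hde]
  exact (g.weylNormSqFrame_comp_equiv (Φ u) (finCongr hdim.symm) ⇑b).symm

end Naturality

/-! ### The pointwise conformal law of the Weyl norm on a manifold -/

/-- **`|W_{ψ²g}|² = ψ⁻⁴ |W_g|²` pointwise on a manifold** modelled on its model space `E`,
`dim E ≥ 3`: for smooth metrics `g`, `g'` with their Levi-Civita connections, `g` Riemannian, and a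
smooth positive function `ψ` with `g' = ψ² g` pointwise, `|W_{g'}|²(x) = (ψ(x)⁴)⁻¹ |W_g|²(x)` —
the conformal covariance `W' = e^{2f} W` of the `(0,4)` Weyl tensor (Besse 1987, Thm. 1.159) read in
the `(0,4)`-norm of `WeylEnergy.lean`. With `dμ_{ψ²g} = ψ⁴ dμ_g` in dimension four this is the
conformal invariance of `∫|W|² dμ` (Gursky–LeBrun 1999, §3). Proof: pull both metrics back along
the inverse chart at `x` (`weylNormSq_comap`), where they have representatives `G` and `(ψ∘Φ)² G`
and the law is `OpensChart.weylNormSqFrame_conformal` (`ChartWeyl.lean`) on an orthonormal frame,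
plus frame independence. [cite: Besse1987, Thm. 1.159] [cite: GurskyLebrun1999, §3, proof of Theorem 1] -/
theorem weylNormSq_conformal_sq {E : Type*} [NormedAddCommGroup E] [NormedSpace ℝ E]
    [FiniteDimensional ℝ E] [CompleteSpace E] (h3 : 3 ≤ finrank ℝ E)
    {X : Type*} [TopologicalSpace X] [ChartedSpace E X] [IsManifold 𝓘(ℝ, E) ∞ X]
    (g g' : PseudoRiemannianMetric 𝓘(ℝ, E) ∞ E (TangentSpace 𝓘(ℝ, E) : X → Type _))
    [g.HasLeviCivita] [g'.HasLeviCivita] (hg : g.IsRiemannian) {ψ : X → ℝ}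
    (hψ : ContMDiff 𝓘(ℝ, E) 𝓘(ℝ) ∞ ψ) (hpos : ∀ x : X, 0 < ψ x)
    (hgg' : ∀ (x : X) (v w : TangentSpace 𝓘(ℝ, E) x), g'.val x v w = ψ x ^ 2 * g.val x v w)
    (x : X) :
    g'.weylNormSq x = (ψ x ^ 4)⁻¹ * g.weylNormSq x := by
  -- the inverse chart at `x`
  set U : TopologicalSpace.Opens E := ⟨(chartAt E x).target, (chartAt E x).open_target⟩ with hU
  set Φ : U → X := fun u ↦ (chartAt E x).symm u with hΦdef
  have hΦ : ContMDiff 𝓘(ℝ, E) 𝓘(ℝ, E) (∞ + 1) Φ := ChartInverseSelf.contMDiff_symm x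
  have hΦ' : ∀ u, Function.Injective (mfderiv 𝓘(ℝ, E) 𝓘(ℝ, E) Φ u) :=
    ChartInverseSelf.injective_mfderiv_symm x
  have hdim : Module.finrank ℝ E = Module.finrank ℝ E := rfl
  have hpb : contMDiff_pullbackBilin 𝓘(ℝ, E) X 𝓘(ℝ, E) U ∞ := contMDiff_pullbackBilin_holds
  set u₀ : U := ⟨chartAt E x x, (chartAt E x).map_source (mem_chart_source E x)⟩ with hu₀
  have hx : Φ u₀ = x := (chartAt E x).left_inv (mem_chart_source E x)
  -- the pulled-back metrics on `U`
  set gU := g.comap hpb Φ hΦ hΦ' hdim with hgU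
  set gU' := g'.comap hpb Φ hΦ hΦ' hdim with hgU'
  haveI : gU.HasLeviCivita := gU.hasLeviCivita
  haveI : gU'.HasLeviCivita := gU'.hasLeviCivita
  have hg' : g'.IsRiemannian := fun y v hv ↦ by
    rw [hgg']
    exact mul_pos (pow_pos (hpos y) 2) (hg y v hv)
  -- naturality of `|W|²`
  rw [← hx, ← g'.weylNormSq_comap hpb hΦ hΦ' hdim hg' u₀, ← g.weylNormSq_comap hpb hΦ hΦ' hdim hg u₀]
  -- representatives on `E`
  set G : E → E →L[ℝ] E →L[ℝ] ℝ := Function.extend (Subtype.val : U → E)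
    (fun y : U ↦ (gU.val y : E →L[ℝ] E →L[ℝ] ℝ)) (fun _ ↦ 0) with hGdef
  set ψE : E → ℝ := fun y ↦ ψ ((chartAt E x).symm y) with hψEdef
  have hG : ∀ y : U, gU.val y = G y := fun y ↦ by
    rw [hGdef, Subtype.val_injective.extend_apply]
  have hG' : ∀ y : U, gU'.val y = (fun y ↦ ψE y ^ 2 • G y) y := by
    intro y
    ext v w
    change g'.val (Φ y) (mfderiv 𝓘(ℝ, E) 𝓘(ℝ, E) Φ y v) (mfderiv 𝓘(ℝ, E) 𝓘(ℝ, E) Φ y w) =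
      ψE y ^ 2 * G y v w
    rw [hgg', ← hG y]
    rfl
  -- the conformal factor in the chart
  have hψs : ContDiffOn ℝ ∞ (fun y ↦ ψE y ^ 2) (U : Set E) := fun y hy ↦
    ((ChartInverseSelf.contDiffAt_comp_symm x hψ hy).pow 2).contDiffWithinAt
  have hψ0 : ∀ y ∈ (U : Set E), ψE y ^ 2 ≠ 0 := fun y _ ↦ pow_ne_zero 2 (hpos _).ne'
  -- an orthonormal basis of `gU` at `u₀`
  have hgU : gU.IsRiemannian := fun u v hv ↦ by
    simp only [hgU, val_comap, pullbackBilin_apply]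
    exact hg _ _ fun h0 ↦ hv (hΦ' u (by rw [map_zero]; exact h0))
  obtain ⟨b, hb⟩ := gU.exists_basis_isOrthonormalFrame (hgU u₀) rfl
  have ha : ψE u₀ ≠ 0 := (hpos _).ne'
  have hax : (fun z ↦ ψE z ^ 2) (u₀ : E) = ψE u₀ ^ 2 := rfl
  have hb' : gU'.IsOrthonormalFrame u₀ (fun i ↦ (ψE u₀)⁻¹ • b i) :=
    OpensChart.isOrthonormalFrame_conformal (c := fun z ↦ ψE z ^ 2) hG hG' u₀ ha hax hb
  rw [gU'.weylNormSq_eq_weylNormSqFrame hb', gU.weylNormSq_eq_weylNormSqFrame hb]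
  exact OpensChart.weylNormSqFrame_conformal (c := fun z ↦ ψE z ^ 2) hG hG' hψs hψ0 h3 u₀ ha hax hb
    (Fintype.card_fin _)

/-! ### The Weyl energy is conformally invariant in dimension four -/

/-- **Conformal invariance of the Weyl energy in dimension four**: on a compact `4`-manifold
(charts into `ℝ⁴`), for smooth metrics `g` (Riemannian), `g'` with their Levi-Civita connections and
a smooth positive `ψ` with `g' = ψ² g` pointwise, `∫_M |W_{g'}|² dV_{g'} = ∫_M |W_g|² dV_g`
(`weylEnergy`, `WeylEnergy.lean`): pointwise `|W_{g'}|² = ψ⁻⁴|W_g|²` (`weylNormSq_conformal_sq`)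
and `dV_{g'} = ψ⁴ dV_g` (`riemannianMeasure_eq_withDensity_of_conformal_sq_four`,
`ConformalVolume.lean`). This is "the `L²` norm of `W` (and of `W⁺`) is conformally invariant"
of Gursky–LeBrun 1999, §3 (for the full Weyl tensor; the chiral halves need the Hodge star) and
the scale/conformal invariance of `∫|W|² dvol` behind the Chang–Gursky–Yang sphere theorem
(2003, p. 106). [cite: GurskyLebrun1999, §3, proof of Theorem 1] [cite: Besse1987, Thm. 1.159] -/
theorem weylEnergy_conformal_sq_four {M : Type*} [TopologicalSpace M] [T2Space M] [T3Space M]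
    [ChartedSpace (EuclideanSpace ℝ (Fin 4)) M] [IsManifold (𝓡 4) ∞ M] [CompactSpace M]
    [MeasurableSpace M] [BorelSpace M]
    (g g' : PseudoRiemannianMetric (𝓡 4) ∞ (EuclideanSpace ℝ (Fin 4)) (TangentSpace (𝓡 4) : M → Type _))
    [g.HasLeviCivita] [g'.HasLeviCivita] (hg : g.IsRiemannian) {ψ : M → ℝ}
    (hψ : ContMDiff (𝓡 4) 𝓘(ℝ) ∞ ψ) (hpos : ∀ x : M, 0 < ψ x)
    (hgg' : ∀ (x : M) (v w : TangentSpace (𝓡 4) x), g'.val x v w = ψ x ^ 2 * g.val x v w) :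
    g'.weylEnergy = g.weylEnergy := by
  have hg' : g'.IsRiemannian := fun y v hv ↦ by
    rw [hgg']
    exact mul_pos (pow_pos (hpos y) 2) (hg y v hv)
  have hψm : Measurable ψ := hψ.continuous.measurable
  have h4 : 3 ≤ finrank ℝ (EuclideanSpace ℝ (Fin 4)) := by
    rw [finrank_euclideanSpace_fin]; norm_num
  have hmeas : Measurable (fun p : M ↦ ENNReal.ofReal (ψ p ^ 4)) :=
    ENNReal.measurable_ofReal.comp (hψm.pow_const 4)
  rw [g'.weylEnergy_eq hg', g.weylEnergy_eq hg,
    riemannianMeasure_eq_withDensity_of_conformal_sq_four (g'.toContMDiffRiemannianMetric hg')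
      (g.toContMDiffRiemannianMetric hg) hψm (fun p v w ↦ hgg' p v w),
    MeasureTheory.lintegral_withDensity_eq_lintegral_mul_non_measurable _ hmeas
      (Filter.Eventually.of_forall fun _ ↦ ENNReal.ofReal_lt_top)]
  refine MeasureTheory.lintegral_congr fun x ↦ ?_
  rw [Pi.mul_apply, weylNormSq_conformal_sq h4 g g' hg hψ hpos hgg' x,
    ← ENNReal.ofReal_mul (pow_nonneg (hpos x).le 4)]
  congr 1
  have hψ4 : ψ x ^ 4 ≠ 0 := pow_ne_zero 4 (hpos x).ne'
  rw [← mul_assoc, mul_inv_cancel₀ hψ4, one_mul]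

end PseudoRiemannianMetric

end Literature.Geometry.Lorentzian

end
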